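import Summits.QuantumFields.BalabanUV.T4Continuum.Support.NE3NestedBlockMeanCovariance
import HarnessLib
/-!
# T⁴ programme, node NE3, route H♮ (ρ-g22-2) · junction J-ne3r2-g8-1, file 2∕3 — THE NESTED-vs-SINGLE-SCALE BLOCK-MEAN BRIDGE:
# `‖bmeanIterW L (j+1) W ξ z − bmeanW (L^{j+1}) W ξ z‖ ≤ (4d²(M−1)²x + 16d·loopRad(d,L,r_j))·M^{−d}Σ_{v∈[0,M)^d}‖ξ(M•z+v)‖`, k-FREE

Row NE3-R2 (unit `b2b-balaban-t4-ne3r2-p1`, gen 8; disprover duty on the NE3 owner's route H♮, design memo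
`HOME/t4/b2b-balaban-t4-ne3-p1/g22/D-ne3p1-g22-1.md`; junction J-ne3r2-g8-1 HOME/CLAIMS.log l.18448, rulings l.18532 ∕ ρ-g23-1 l.18554).
WHY.  Step S3 of route H♮ forces the gauge potential of the co-closed chain to be the NESTED transported block mean
(`QstrIter L k W (gaugeDir W ζ′) = gaugeDir (cavgIter L k W) (bmeanIterW L k W ζ′) + DefIter`, leaf-04's K3 file 2
`NE3ExactLineSumsTower.QstrIter_gaugeDir_eq`), whose transports run through the averaging TOWER `W, cavg L W, …`, while S4's Landau-kill
error is closed by the covariant block Poincaré inequality K2 (leaf-04, `NE3CovariantBlockPoincare`), typed for the SINGLE-SCALE pair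
(`btree M W z`, `bmeanW M W`), `M = L^k` (K4-c roots with the same `btree`, ρ-g23-1: J3 ≡ 0).  The K6 assembly needs exactly ONE comparison:
`bmeanW (L^k) W ξ` versus `bmeanIterW L k W ξ`, with a k-FREE constant.

THIS FILE (all [folklore]; 0 `def`, 0 sorry), on file 1 `NE3NestedBlockMeanCovariance`:
§4 THE INDUCTION `norm_bmeanIterW_sub_iterate_bmean_le` (`L ≥ 2`; class `IsUnitaryCfg W`, `0 ≤ x`, `LevelSmall d L j x`, `SmallField W x`;
   hypothesis: every bond with both endpoints in the `L^{j+1}`-block within `b` of `1`):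
   `‖bmeanIterW L (j+1) W μ z − (bmean L)^[j+1] μ z‖ ≤ (4d(L^{j+1}−1)b + 16d·loopRad(r_j) − 16d·L^j·loopRad x)·(block mean of ‖μ‖)`
   — level `i` of the nesting reads interior bonds of `cavgIter L i W` within `b_i` of `1` (`b₀ = b`, `b_{i+1} = L·b_i + 4·loopRad r_i`:
   file 1 `norm_cavg_sub_one_le`), costs `2dL·b_i` per replaced `L`-mean (file 1 `norm_bmeanW_sub_bmean_le`, Jensen for the later means),
   and the flat means compose (NE3-R2's `NE3FramePotGauge.iterate_bmean_apply`); the slack form closes the induction (`const_step`), so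
   the constant is k-FREE (the per-level costs are geometric from the TOP, as in K3's `DSum_le_top`); `pow_mul_loopRad_le_iterate`,
   `errConst_nonneg`.
§5 **THE BRIDGE `norm_bmeanIterW_sub_bmeanW_le`** (comb gauge `W₀ = W^{btree M W z}`: all block bonds within `d(M−1)x` of `1`
   (file 1 `comb_nearOne`); the single-scale mean is the FLAT mean of the dressed field (`bmeanW_eq_bmean_comb`, `iterate_bmean_apply`),
   the nested mean is the nested mean of the dressed data (`bmeanIterW_gaugeAct`, `btree_corner`), so §4 applies):
   `‖bmeanIterW L (j+1) W ξ z − bmeanW (L^{j+1}) W ξ z‖ ≤ (4d²(L^{j+1}−1)²x + 16d·loopRad(d,L,(prop1Radius)^[j] x))·((L^{j+1})^d)⁻¹·Σ_{v∈[0,L^{j+1})^d}‖ξ(L^{j+1}•z+v)‖`,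
   and its `ℓ²` twin over the blocks of a torus **`sum_norm_bmeanIterW_sub_bmeanW_sq_le`**
   (`Σ_{z∈[0,N)^d} M^d‖…‖² ≤ C²·Σ_{y∈[0,MN)^d}‖ξ y‖²`; Jensen `NE3ExactLineSums.blockMean_norm_sq_le` + `sum_periodBox_blocks`; no periodicity).
POWER COUNT for route H♮ (design currency `θ = M²a ≤ b∕L²`, `loopRad(r_j) = O(L²r_j) = O(b∕L²)`): the bridge constant is `O(b∕L²)`, so in S4
`‖Φ^{btree}(bmeanW ζ′) − Φ^{btree}(bmeanIterW ζ′)‖_{ℓ²} ≤ C‖ζ′‖ ≤ C(M∕ε)‖Y‖ = O(ε)·M‖Y‖` — the same order as K2's own defect term; the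
three-term split of S4's `ζ′ − Φ^{btree}(bmeanIterW ζ′)` is K2 (leaf-04) + THIS + 0 (J3, ρ-g23-1).

HONEST FRAMING.  Bookkeeping kinematics of OUR transported block means at a background in the multi-level small-field class; nothing
about Bałaban's minimisers; (P♮)_W, (ML_w) at `W ≠ 1`, T-E_w and NE3 are NOT proved here; spine PROVED 0∕9; finite T⁴ rung (B)+1 —
NOT infinite volume, NOT mass gap, NOT BetaPertH, NOT Clay.  ABSOLUTE RULE kept: no printed sentence is a hypothesis (context only:
[Balaban1985Averaging] (8) p. 18, (42)–(45) pp. 23–25).  PLACEMENT: `Summits/QuantumFields/BalabanUV/`; moves nothing.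
HONEST DEPENDENCY: continuum YM on T⁴ ⇐ BetaPertH ∧ nine spine estimates (0/9 proved); BetaPertH ⇐ (D1) ∧ (D4) ∧ CAP+tail;
G-an2-4 gates asym, D1 and NE2/3/4.
-/

set_option autoImplicit false

open scoped BigOperators Matrix.Norms.L2Operator
open Finset

namespace Summit.QuantumFields.BalabanUV.T4Continuum.NE3NestedBlockMeanBridge

open Literature.MathematicalPhysics.QuantumFieldTheory.Balaban1983to89
open B7Prop1Explicit B7Prop2Explicit
open T4AveragingDeficitWall (IsUnitaryCfg SmallField Ad hol_flat bavg_flat)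
open T4AveragingDeficitNonAbelian (Ad_mul Ad_sub)
open AveragingDeficitTransport (norm_Ad_of_unitary mem_U1_of_unitary)
open AveragingDeficitNearIdentity (Ad_one norm_Ad_sub_le norm_hol_sub_one_le_of_bonds Ad_sum Ad_real_smul)
open AveragingDeficitChartCalculus (cavg)
open AveragingDeficitTwoLevelPrep (prop1Radius)
open AveragingDeficitMultiLevelPrep (cavgIter LevelSmall prop1Radius_nonneg)
open AveragingDeficitBlockDensity (btree bseg btree_mem norm_cavg_inv_bseg_sub_one_le cavg_mem)
open AveragingDeficitLocality (bondsOf)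
open AveragingDeficitTransportCalc (bondsOf_append mem_bondsOf_seg_iff)
open NE3TangentCovariantTower (step_small cavgIter_succ)
open NE3CovariantBlockMean (bmeanW bmeanIterW bmeanIterW_succ bmeanIterW_zero boxVec_bounds)
open NE3GaugeDirFrames (Ad_Ad_inv)
open NE3CombGauge (btree_corner norm_comb_sub_one_le_single isUnitaryCfg_comb smallField_comb)
open NE3FramePotGauge (bmean iterate_bmean_apply)
open NE3ExactLineSumsTower (sq_mul_loopRad_le DSum DSum_succ DSum_le_top)
open NE3ExactLineSums (blockMean_norm_sq_le)
open NE3BlockLineAverage (sum_univ_boxVec sum_periodBox_blocks)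
open SpreadLift (loopRad loopRad_le loopBound_of_smallField)
open T4AveragingDeficitWallBoundary (periodBox mem_periodBox)

open NE3NestedBlockMeanCovariance

noncomputable section

variable {d : ℕ} {n : Type*} [Fintype n] [DecidableEq n]

/-! ## §4 The nested mean against the flat mean in a near-identity box — the k-free induction -/

omit [Fintype n] [DecidableEq n] in
/-- Down the tower the loop radius grows at least like `L` per level: `L^j·loopRad x ≤ loopRad ((prop1Radius)^[j] x)` (`L ≥ 1`,
`x ≥ 0`; indeed `L²` per level, `sq_mul_loopRad_le`). [folklore] -/
theorem pow_mul_loopRad_le_iterate {L : ℕ} (hL : 1 ≤ L) : ∀ (j : ℕ) {x : ℝ}, 0 ≤ x →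
    (L : ℝ) ^ j * loopRad d L x ≤ loopRad d L ((prop1Radius d L)^[j] x)
  | 0, x, _ => by simp
  | j + 1, x, hx => by
      rw [Function.iterate_succ_apply, pow_succ]
      have hx1 : 0 ≤ prop1Radius d L x := prop1Radius_nonneg (d := d) (L := L) hx
      have ih := pow_mul_loopRad_le_iterate hL j hx1
      have hsq := sq_mul_loopRad_le (d := d) L x
      have hL1 : (1 : ℝ) ≤ L := by exact_mod_cast hL
      have hρ : 0 ≤ loopRad d L x := by unfold loopRad; positivity
      have hLj : (0 : ℝ) ≤ (L : ℝ) ^ j := by positivity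
      have hLL : (L : ℝ) ≤ (L : ℝ) ^ 2 := by nlinarith
      have h1 : (L : ℝ) * loopRad d L x ≤ (L : ℝ) ^ 2 * loopRad d L x := mul_le_mul_of_nonneg_right hLL hρ
      calc (L : ℝ) ^ j * L * loopRad d L x = (L : ℝ) ^ j * ((L : ℝ) * loopRad d L x) := by ring
        _ ≤ (L : ℝ) ^ j * loopRad d L (prop1Radius d L x) := mul_le_mul_of_nonneg_left (h1.trans hsq) hLj
        _ ≤ loopRad d L ((prop1Radius d L)^[j] (prop1Radius d L x)) := ih

omit [Fintype n] [DecidableEq n] in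
/-- The error constant of the induction is non-negative. [folklore] -/
theorem errConst_nonneg {L : ℕ} (hL : 1 ≤ L) (j : ℕ) {x b : ℝ} (hx : 0 ≤ x) (hb : 0 ≤ b) :
    0 ≤ 4 * (d : ℝ) * ((L : ℝ) ^ (j + 1) - 1) * b + 16 * d * loopRad d L ((prop1Radius d L)^[j] x)
      - 16 * d * (L : ℝ) ^ j * loopRad d L x := by
  have h := pow_mul_loopRad_le_iterate (d := d) hL j hx
  have hL1 : (1 : ℝ) ≤ L := by exact_mod_cast hL
  have hLj : (1 : ℝ) ≤ (L : ℝ) ^ (j + 1) := one_le_pow₀ hL1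
  have hd : (0 : ℝ) ≤ d := Nat.cast_nonneg d
  nlinarith [mul_nonneg hd hb, mul_nonneg (mul_nonneg hd hb) (sub_nonneg.mpr hLj), mul_nonneg hd (sub_nonneg.mpr h)]

omit [Fintype n] [DecidableEq n] in
/-- The arithmetic of the induction step (`P = L^j`, `ℓ = loopRad x`, `ℓ₁ = loopRad (prop1Radius x) ≥ L²ℓ`, `T` = top radius term):
the level cost `2dLb` and the IH at radius `(L·b + 4ℓ, prop1Radius x)` fit under the next constant when `L ≥ 2`. [folklore] -/
theorem const_step {d' L P b ℓ ℓ₁ T : ℝ} (hd : 0 ≤ d') (hL : 2 ≤ L) (hP : 0 ≤ P) (hb : 0 ≤ b) (hℓ : 0 ≤ ℓ)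
    (hℓ₁ : L ^ 2 * ℓ ≤ ℓ₁) :
    (4 * d' * (P * L - 1) * (L * b + 4 * ℓ) + 16 * d' * T - 16 * d' * P * ℓ₁) + 2 * d' * L * b
      ≤ 4 * d' * (P * L * L - 1) * b + 16 * d' * T - 16 * d' * (P * L) * ℓ := by
  have f1 : 0 ≤ d' * b * (L - 2) := mul_nonneg (mul_nonneg hd hb) (by linarith)
  have f2 : 0 ≤ d' * ℓ * (P * L * (L - 2) + 1) := by
    have : 0 ≤ P * L * (L - 2) := mul_nonneg (mul_nonneg hP (by linarith)) (by linarith)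
    exact mul_nonneg (mul_nonneg hd hℓ) (by linarith)
  have f3 : 0 ≤ d' * (P * ℓ₁ - P * (L ^ 2 * ℓ)) :=
    mul_nonneg hd (sub_nonneg.mpr (mul_le_mul_of_nonneg_left hℓ₁ hP))
  nlinarith [f1, f2, f3]

/-- **THE NESTED TRANSPORTED MEAN AGAINST THE FLAT MEAN IN A NEAR-IDENTITY BOX** (the induction; `L ≥ 2`; class `IsUnitaryCfg W`,
`0 ≤ x`, `LevelSmall d L j x`, `SmallField W x`): if every bond of `W` with both endpoints in the block `[M•z, M•z + (M−1)𝟙]`,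
`M = L^{j+1}`, is within `b ≥ 0` of `1`, then for every site field `μ`
`‖bmeanIterW L (j+1) W μ z − (bmean L)^[j+1] μ z‖ ≤ (4d(L^{j+1} − 1)·b + 16d·loopRad((prop1Radius)^[j] x) − 16d·L^j·loopRad x)·M^{−d}Σ_{v∈[0,M)^d}‖μ(M•z+v)‖`
— level `i` of the nesting reads interior bonds of `cavgIter L i W` within `b_i` of `1` (`b₀ = b`, `b_{i+1} = L·b_i + 4·loopRad r_i`:
`norm_cavg_sub_one_le`), costs `2dL·b_i` per replaced `L`-mean (`norm_bmeanW_sub_bmean_le`, Jensen for the later means), and the flat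
means compose (`iterate_bmean_apply`); the sum is geometric from the TOP (`const_step`), so the constant is k-FREE. [folklore] -/
theorem norm_bmeanIterW_sub_iterate_bmean_le [Nonempty n] {L : ℕ} (hL : 2 ≤ L) (j : ℕ) :
    ∀ {W : Site d → Fin d → (Matrix n n ℂ)ˣ} {x : ℝ}, IsUnitaryCfg W → 0 ≤ x → LevelSmall d L j x → SmallField W x →
    ∀ {b : ℝ}, 0 ≤ b → ∀ (z : Site d),
      (∀ (y : Site d) (ν : Fin d), ((L ^ (j + 1) : ℕ) : ℤ) • z ≤ y →
          y + e ν ≤ ((L ^ (j + 1) : ℕ) : ℤ) • z + (fun _ => ((L ^ (j + 1) : ℕ) : ℤ) - 1) →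
          ‖((W y ν : (Matrix n n ℂ)ˣ) : Matrix n n ℂ) - 1‖ ≤ b) →
      ∀ (mu : Site d → Matrix n n ℂ),
        ‖bmeanIterW L (j + 1) W mu z - (bmean L)^[j + 1] mu z‖
          ≤ (4 * d * ((L : ℝ) ^ (j + 1) - 1) * b + 16 * d * loopRad d L ((prop1Radius d L)^[j] x)
              - 16 * d * (L : ℝ) ^ j * loopRad d L x)
            * ((((L ^ (j + 1) : ℕ) : ℝ) ^ d)⁻¹ * ∑ v ∈ periodBox (d := d) (L ^ (j + 1)), ‖mu (((L ^ (j + 1) : ℕ) : ℤ) • z + v)‖) := by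
  have hL1 : 1 ≤ L := le_trans (by norm_num) hL
  have hL2 : (2 : ℝ) ≤ L := by exact_mod_cast hL
  have hd : (0 : ℝ) ≤ d := Nat.cast_nonneg d
  induction j with
  | zero =>
      intro W x hWu hx hsm hWx b hb0 z hb mu
      rw [bmeanIterW_succ, bmeanIterW_zero, Function.iterate_succ_apply, Function.iterate_zero_apply]
      simp only [zero_add, pow_one, pow_zero, Function.iterate_zero, id_eq] at hb ⊢
      have h1 := norm_bmeanW_sub_bmean_le hWu hb0 hb mu (y := z) le_rfl le_rfl
      have hsum : ∑ r : Fin d → Fin L, ((L : ℝ) ^ d)⁻¹ * ‖mu ((L : ℤ) • z + boxVec L r)‖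
          = ((L : ℝ) ^ d)⁻¹ * ∑ v ∈ periodBox (d := d) L, ‖mu ((L : ℤ) • z + v)‖ := by
        rw [Finset.mul_sum]
        exact sum_univ_boxVec L (fun v => ((L : ℝ) ^ d)⁻¹ * ‖mu ((L : ℤ) • z + v)‖)
      rw [hsum] at h1
      refine h1.trans (mul_le_mul_of_nonneg_right ?_ (by positivity))
      nlinarith [mul_nonneg (mul_nonneg hd hb0) (sub_nonneg.mpr hL2)]
  | succ j ih =>
      intro W x hWu hx hsm hWx b hb0 z hb mu
      obtain ⟨h512, hW₁u, hr0, hW₁x⟩ := step_small hL1 hWu hx hsm.1 hWx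
      have hρ : 0 ≤ loopRad d L x := by unfold loopRad; positivity
      -- casts of the two block sizes
      have hMK : ((L ^ (j + 1 + 1) : ℕ) : ℤ) = (L : ℤ) * ((L ^ (j + 1) : ℕ) : ℤ) := by push_cast; ring
      have hL0 : (0 : ℤ) ≤ (L : ℤ) := by positivity
      have hL1z : (1 : ℤ) ≤ (L : ℤ) := by exact_mod_cast hL1
      -- (i) the averaged background is near `1` on the coarse box
      have hb₁ : ∀ (y : Site d) (ν : Fin d), ((L ^ (j + 1) : ℕ) : ℤ) • z ≤ y →
          y + e ν ≤ ((L ^ (j + 1) : ℕ) : ℤ) • z + (fun _ => ((L ^ (j + 1) : ℕ) : ℤ) - 1) →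
          ‖((cavg L W y ν : (Matrix n n ℂ)ˣ) : Matrix n n ℂ) - 1‖ ≤ L * b + 4 * loopRad d L x := by
        intro y ν hy hy'
        refine norm_cavg_sub_one_le hL1 hWu hx h512 hWx hb ?_ ?_
        · intro ι
          have h1 : ((L ^ (j + 1) : ℕ) : ℤ) * z ι ≤ y ι := by simpa using hy ι
          have h2 := mul_le_mul_of_nonneg_left h1 hL0
          simp only [Pi.smul_apply, smul_eq_mul, hMK, mul_assoc]
          exact h2
        · intro ι
          have h1 : y ι + e ν ι ≤ ((L ^ (j + 1) : ℕ) : ℤ) * z ι + (((L ^ (j + 1) : ℕ) : ℤ) - 1) := by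
            simpa using hy' ι
          have h2 := mul_le_mul_of_nonneg_left h1 hL0
          simp only [Pi.smul_apply, Pi.add_apply, smul_eq_mul, hMK]
          nlinarith
      have hb₁0 : 0 ≤ (L : ℝ) * b + 4 * loopRad d L x := by positivity
      -- (ii) the induction hypothesis at the averaged background on the coarse data
      have hI := ih hW₁u hr0 hsm.2 hW₁x hb₁0 z hb₁ (bmeanW L W mu)
      -- (iii) the per-sub-block data
      have hblock : ∀ v ∈ periodBox (d := d) (L ^ (j + 1)),
          ‖bmeanW L W mu (((L ^ (j + 1) : ℕ) : ℤ) • z + v) - bmean L mu (((L ^ (j + 1) : ℕ) : ℤ) • z + v)‖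
              ≤ 2 * d * L * b * ∑ r : Fin d → Fin L, ((L : ℝ) ^ d)⁻¹ * ‖mu ((L : ℤ) • (((L ^ (j + 1) : ℕ) : ℤ) • z + v) + boxVec L r)‖
            ∧ ‖bmeanW L W mu (((L ^ (j + 1) : ℕ) : ℤ) • z + v)‖
              ≤ ∑ r : Fin d → Fin L, ((L : ℝ) ^ d)⁻¹ * ‖mu ((L : ℤ) • (((L ^ (j + 1) : ℕ) : ℤ) • z + v) + boxVec L r)‖ := by
        intro v hv
        rw [mem_periodBox] at hv
        refine ⟨norm_bmeanW_sub_bmean_le hWu hb0 hb mu ?_ ?_, norm_bmeanW_le_mean hWu mu _⟩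
        · intro ι
          have h1 := (hv ι).1
          simp only [Pi.smul_apply, Pi.add_apply, smul_eq_mul, hMK]
          nlinarith
        · intro ι
          have h1 := (hv ι).2
          simp only [Pi.smul_apply, Pi.add_apply, smul_eq_mul, hMK]
          nlinarith
      -- (iv) the composition of the sub-block means
      have hcomp : ∑ v ∈ periodBox (d := d) (L ^ (j + 1)),
            ∑ r : Fin d → Fin L, ((L : ℝ) ^ d)⁻¹ * ‖mu ((L : ℤ) • (((L ^ (j + 1) : ℕ) : ℤ) • z + v) + boxVec L r)‖
          = ((L : ℝ) ^ d)⁻¹ * ∑ w ∈ periodBox (d := d) (L ^ (j + 1 + 1)), ‖mu (((L ^ (j + 1 + 1) : ℕ) : ℤ) • z + w)‖ := by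
        rw [Finset.mul_sum, pow_succ' L (j + 1),
          ← sum_periodBox_blocks L (L ^ (j + 1)) hL1 (fun w => ((L : ℝ) ^ d)⁻¹ * ‖mu (((L * L ^ (j + 1) : ℕ) : ℤ) • z + w)‖)]
        refine Finset.sum_congr rfl fun v _ => ?_
        rw [sum_univ_boxVec L (fun u => ((L : ℝ) ^ d)⁻¹ * ‖mu ((L : ℤ) • (((L ^ (j + 1) : ℕ) : ℤ) • z + v) + u)‖)]
        refine Finset.sum_congr rfl fun u _ => ?_
        congr 3
        rw [smul_add, smul_smul, add_assoc]
        push_cast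
        rfl
      -- (v) the flat difference through the explicit sum form of the iterated flat mean
      have hflat : ‖(bmean L)^[j + 1] (bmeanW L W mu) z - (bmean L)^[j + 1] (bmean L mu) z‖
          ≤ (((L ^ (j + 1) : ℕ) : ℝ) ^ d)⁻¹ * ∑ v ∈ periodBox (d := d) (L ^ (j + 1)),
              ‖bmeanW L W mu (((L ^ (j + 1) : ℕ) : ℤ) • z + v) - bmean L mu (((L ^ (j + 1) : ℕ) : ℤ) • z + v)‖ := by
        rw [iterate_bmean_apply hL1, iterate_bmean_apply hL1, ← smul_sub, ← Finset.sum_sub_distrib, norm_smul, Real.norm_eq_abs,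
          abs_of_nonneg (by positivity)]
        exact mul_le_mul_of_nonneg_left (norm_sum_le _ _) (by positivity)
      -- (vi) assembly
      rw [bmeanIterW_succ, Function.iterate_succ_apply]
      have hKd : (0 : ℝ) ≤ (((L ^ (j + 1) : ℕ) : ℝ) ^ d)⁻¹ := by positivity
      have hE0 := errConst_nonneg (d := d) hL1 j hr0 hb₁0
      set S : ℝ := ∑ w ∈ periodBox (d := d) (L ^ (j + 1 + 1)), ‖mu (((L ^ (j + 1 + 1) : ℕ) : ℤ) • z + w)‖ with hS
      have hS0 : 0 ≤ S := Finset.sum_nonneg fun _ _ => norm_nonneg _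
      -- the two pieces against the composed mean
      have hA : ‖bmeanIterW L (j + 1) (cavg L W) (bmeanW L W mu) z - (bmean L)^[j + 1] (bmeanW L W mu) z‖
          ≤ (4 * d * ((L : ℝ) ^ (j + 1) - 1) * (L * b + 4 * loopRad d L x)
              + 16 * d * loopRad d L ((prop1Radius d L)^[j] (prop1Radius d L x))
              - 16 * d * (L : ℝ) ^ j * loopRad d L (prop1Radius d L x))
            * ((((L ^ (j + 1) : ℕ) : ℝ) ^ d)⁻¹ * (((L : ℝ) ^ d)⁻¹ * S)) := by
        refine hI.trans (mul_le_mul_of_nonneg_left ?_ hE0)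
        rw [← hcomp]
        exact mul_le_mul_of_nonneg_left (Finset.sum_le_sum fun v hv => (hblock v hv).2) hKd
      have hB : ‖(bmean L)^[j + 1] (bmeanW L W mu) z - (bmean L)^[j + 1] (bmean L mu) z‖
          ≤ 2 * d * L * b * ((((L ^ (j + 1) : ℕ) : ℝ) ^ d)⁻¹ * (((L : ℝ) ^ d)⁻¹ * S)) := by
        refine hflat.trans ?_
        rw [← hcomp]
        calc (((L ^ (j + 1) : ℕ) : ℝ) ^ d)⁻¹ * ∑ v ∈ periodBox (d := d) (L ^ (j + 1)),
              ‖bmeanW L W mu (((L ^ (j + 1) : ℕ) : ℤ) • z + v) - bmean L mu (((L ^ (j + 1) : ℕ) : ℤ) • z + v)‖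
            ≤ (((L ^ (j + 1) : ℕ) : ℝ) ^ d)⁻¹ * ∑ v ∈ periodBox (d := d) (L ^ (j + 1)),
              2 * d * L * b * ∑ r : Fin d → Fin L, ((L : ℝ) ^ d)⁻¹ * ‖mu ((L : ℤ) • (((L ^ (j + 1) : ℕ) : ℤ) • z + v) + boxVec L r)‖ :=
              mul_le_mul_of_nonneg_left (Finset.sum_le_sum fun v hv => (hblock v hv).1) hKd
          _ = 2 * d * L * b * ((((L ^ (j + 1) : ℕ) : ℝ) ^ d)⁻¹ * ∑ v ∈ periodBox (d := d) (L ^ (j + 1)),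
              ∑ r : Fin d → Fin L, ((L : ℝ) ^ d)⁻¹ * ‖mu ((L : ℤ) • (((L ^ (j + 1) : ℕ) : ℤ) • z + v) + boxVec L r)‖) := by
              rw [← Finset.mul_sum]; ring
      -- the two block-size inverses combine
      have hinv : (((L ^ (j + 1) : ℕ) : ℝ) ^ d)⁻¹ * (((L : ℝ) ^ d)⁻¹ * S) = (((L ^ (j + 1 + 1) : ℕ) : ℝ) ^ d)⁻¹ * S := by
        push_cast
        rw [← mul_assoc, ← mul_inv, ← mul_pow]
        ring
      rw [hinv] at hA hB
      have hmean0 : 0 ≤ (((L ^ (j + 1 + 1) : ℕ) : ℝ) ^ d)⁻¹ * S := by positivity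
      -- the constants
      have hconst := const_step (T := loopRad d L ((prop1Radius d L)^[j + 1] x)) hd hL2 (pow_nonneg (by positivity) j) hb0 hρ
        (sq_mul_loopRad_le (d := d) L x)
      rw [Function.iterate_succ_apply] at hA ⊢
      calc ‖bmeanIterW L (j + 1) (cavg L W) (bmeanW L W mu) z - (bmean L)^[j + 1] (bmean L mu) z‖
          ≤ ‖bmeanIterW L (j + 1) (cavg L W) (bmeanW L W mu) z - (bmean L)^[j + 1] (bmeanW L W mu) z‖
            + ‖(bmean L)^[j + 1] (bmeanW L W mu) z - (bmean L)^[j + 1] (bmean L mu) z‖ := norm_sub_le_norm_sub_add_norm_sub _ _ _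
        _ ≤ ((4 * d * ((L : ℝ) ^ (j + 1) - 1) * (L * b + 4 * loopRad d L x)
              + 16 * d * loopRad d L ((prop1Radius d L)^[j] (prop1Radius d L x))
              - 16 * d * (L : ℝ) ^ j * loopRad d L (prop1Radius d L x)) + 2 * d * L * b)
            * ((((L ^ (j + 1 + 1) : ℕ) : ℝ) ^ d)⁻¹ * S) := by rw [add_mul]; exact add_le_add hA hB
        _ ≤ _ := by
            refine mul_le_mul_of_nonneg_right ?_ hmean0
            rw [← Function.iterate_succ_apply (prop1Radius d L) j x] 
            have e1 : (L : ℝ) ^ (j + 1) = (L : ℝ) ^ j * L := pow_succ _ _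
            have e2 : (L : ℝ) ^ (j + 1 + 1) = (L : ℝ) ^ j * L * L := by rw [pow_succ, pow_succ]
            rw [e1, e2]
            linarith [hconst]


/-! ## §5 THE BRIDGE: the nested transported mean against the single-scale transported mean -/

/-- **THE NESTED-vs-SINGLE-SCALE BLOCK-MEAN BRIDGE** (junction J-ne3r2-g8-1 (J2) of route H♮; multi-level small-field class
`IsUnitaryCfg W`, `0 ≤ x`, `LevelSmall d L j x`, `SmallField W x`, `L ≥ 2`; `M = L^{j+1}`, `r_j = (prop1Radius)^[j] x`):
`‖bmeanIterW L (j+1) W ξ z − bmeanW (L^{j+1}) W ξ z‖ ≤ (4d²(M−1)²x + 16d·loopRad(d,L,r_j))·M^{−d}Σ_{v∈[0,M)^d}‖ξ(M•z+v)‖` —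
k-FREE (`(M−1)²x ≤ θ = M²x`, the design's `b∕L²`; the loop part is the top level's): in the comb gauge `W₀ = W^{btree M W z}` of the block
(all block bonds within `d(M−1)x` of `1`, `comb_nearOne`) the single-scale mean is the FLAT mean of the dressed field
(`bmeanW_eq_bmean_comb`, `iterate_bmean_apply`) and the nested mean is the nested mean of the dressed data (`bmeanIterW_gaugeAct`,
`btree_corner`), so §4 applies. S4 of route H♮ reads `ψ′ = −bmeanIterW L k W ζ′` (K3 `QstrIter_gaugeDir_eq`) against K2's
`Φ^{btree}(bmeanW (L^k) W ζ′)`; this is the missing comparison, `O(θ)·‖ζ′‖` in `ℓ²` (next theorem). [folklore] -/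
theorem norm_bmeanIterW_sub_bmeanW_le [Nonempty n] {L : ℕ} (hL : 2 ≤ L) (j : ℕ) {W : Site d → Fin d → (Matrix n n ℂ)ˣ} {x : ℝ}
    (hWu : IsUnitaryCfg W) (hx : 0 ≤ x) (hsm : LevelSmall d L j x) (hWx : SmallField W x)
    (ξ : Site d → Matrix n n ℂ) (z : Site d) :
    ‖bmeanIterW L (j + 1) W ξ z - bmeanW (L ^ (j + 1)) W ξ z‖
      ≤ (4 * (d : ℝ) ^ 2 * ((L : ℝ) ^ (j + 1) - 1) ^ 2 * x + 16 * d * loopRad d L ((prop1Radius d L)^[j] x))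
        * ((((L ^ (j + 1) : ℕ) : ℝ) ^ d)⁻¹ * ∑ v ∈ periodBox (d := d) (L ^ (j + 1)), ‖ξ (((L ^ (j + 1) : ℕ) : ℤ) • z + v)‖) := by
  have hL1 : 1 ≤ L := le_trans (by norm_num) hL
  have hd : (0 : ℝ) ≤ d := Nat.cast_nonneg d
  have hMr : ((L ^ (j + 1) : ℕ) : ℝ) = (L : ℝ) ^ (j + 1) := by push_cast; rfl
  have hM1 : (1 : ℝ) ≤ (L : ℝ) ^ (j + 1) := one_le_pow₀ (by exact_mod_cast hL1)
  -- the comb gauge of the block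
  have hu : ∀ y, btree (L ^ (j + 1)) W z y ∈ unitaryUnits (Matrix n n ℂ) := fun y => btree_mem hWu (L ^ (j + 1)) z y
  have hW₀u : IsUnitaryCfg (gaugeAct (btree (L ^ (j + 1)) W z) W) := isUnitaryCfg_comb hWu (L ^ (j + 1)) z
  have hW₀x : SmallField (gaugeAct (btree (L ^ (j + 1)) W z) W) x := smallField_comb hWu hWx (L ^ (j + 1)) z
  -- covariance: the nested mean of the dressed data in the comb gauge IS the nested mean (`u = 1` at the corner)
  have hcov := bmeanIterW_gaugeAct hL1 j hWu hx hsm hWx hu ξ z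
  rw [btree_corner, Ad_one] at hcov
  -- the single-scale mean is the iterated FLAT mean of the dressed field
  have hsingle : bmeanW (L ^ (j + 1)) W ξ z = (bmean L)^[j + 1] (fun y => Ad (btree (L ^ (j + 1)) W z y) (ξ y)) z := by
    rw [bmeanW_eq_bmean_comb, NE3FramePotGauge.bmean_apply, iterate_bmean_apply hL1 (j + 1)]
  -- the block bonds of the comb gauge are within `d(M−1)x` of `1`
  have hb0 : 0 ≤ (d : ℝ) * ((L : ℝ) ^ (j + 1) - 1) * x := by
    have : (0 : ℝ) ≤ (L : ℝ) ^ (j + 1) - 1 := sub_nonneg.mpr hM1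
    positivity
  have hbM : ∀ (y : Site d) (ν : Fin d), ((L ^ (j + 1) : ℕ) : ℤ) • z ≤ y →
      y + e ν ≤ ((L ^ (j + 1) : ℕ) : ℤ) • z + (fun _ => ((L ^ (j + 1) : ℕ) : ℤ) - 1) →
      ‖((gaugeAct (btree (L ^ (j + 1)) W z) W y ν : (Matrix n n ℂ)ˣ) : Matrix n n ℂ) - 1‖ ≤ (d : ℝ) * ((L : ℝ) ^ (j + 1) - 1) * x := by
    intro y ν hy hy'
    refine (comb_nearOne hWu hx hWx z y ν hy hy').trans ?_
    rw [hMr]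
    have : (0 : ℝ) ≤ ((L : ℝ) ^ (j + 1) - 1) * x := mul_nonneg (sub_nonneg.mpr hM1) hx
    nlinarith
  have hmain := norm_bmeanIterW_sub_iterate_bmean_le hL j hW₀u hx hsm hW₀x hb0 z hbM
    (fun y => Ad (btree (L ^ (j + 1)) W z y) (ξ y))
  rw [hcov, ← hsingle] at hmain
  simp only [norm_Ad_of_unitary (hu _)] at hmain
  refine hmain.trans (mul_le_mul_of_nonneg_right ?_ (by positivity))
  have hρ : 0 ≤ loopRad d L x := by unfold loopRad; positivity
  have hLj : (0 : ℝ) ≤ (L : ℝ) ^ j := by positivity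
  nlinarith [mul_nonneg (mul_nonneg hd hLj) hρ, sub_nonneg.mpr hM1]

/-- **THE BRIDGE IN `ℓ²` OVER THE TORUS BLOCKS** (same class; any `N`; no periodicity needed):
`Σ_{z∈[0,N)^d} M^d·‖bmeanIterW L (j+1) W ξ z − bmeanW M W ξ z‖² ≤ C²·Σ_{y∈[0,MN)^d}‖ξ y‖²`, `C = 4d²(M−1)²x + 16d·loopRad(r_j)` —
Jensen per block (`blockMean_norm_sq_le`) and the block tiling (`sum_periodBox_blocks`); in route H♮'s S4 this is
`‖Φ^{btree}(bmean_single ζ′) − Φ^{btree}(bmean_nested ζ′)‖_{ℓ²(F)} ≤ C‖ζ′‖ ≤ C(M∕ε)‖Y‖ = O(ε)·M‖Y‖` since `C = O(b∕L²) ≤ O(ε²)`. [folklore] -/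
theorem sum_norm_bmeanIterW_sub_bmeanW_sq_le [Nonempty n] {L : ℕ} (hL : 2 ≤ L) (j : ℕ) {W : Site d → Fin d → (Matrix n n ℂ)ˣ}
    {x : ℝ} (hWu : IsUnitaryCfg W) (hx : 0 ≤ x) (hsm : LevelSmall d L j x) (hWx : SmallField W x)
    (ξ : Site d → Matrix n n ℂ) (N : ℕ) :
    ∑ z ∈ periodBox (d := d) N, ((L : ℝ) ^ (j + 1)) ^ d * ‖bmeanIterW L (j + 1) W ξ z - bmeanW (L ^ (j + 1)) W ξ z‖ ^ 2
      ≤ (4 * (d : ℝ) ^ 2 * ((L : ℝ) ^ (j + 1) - 1) ^ 2 * x + 16 * d * loopRad d L ((prop1Radius d L)^[j] x)) ^ 2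
        * ∑ y ∈ periodBox (d := d) (L ^ (j + 1) * N), ‖ξ y‖ ^ 2 := by
  have hL1 : 1 ≤ L := le_trans (by norm_num) hL
  have hM1 : 1 ≤ L ^ (j + 1) := Nat.one_le_pow _ _ hL1
  have hMr : ((L ^ (j + 1) : ℕ) : ℝ) = (L : ℝ) ^ (j + 1) := by push_cast; rfl
  have hMpos : (0 : ℝ) < ((L : ℝ) ^ (j + 1)) ^ d := by positivity
  set C : ℝ := 4 * (d : ℝ) ^ 2 * ((L : ℝ) ^ (j + 1) - 1) ^ 2 * x + 16 * d * loopRad d L ((prop1Radius d L)^[j] x) with hC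
  rw [← sum_periodBox_blocks (L ^ (j + 1)) N hM1 (fun y => ‖ξ y‖ ^ 2), Finset.mul_sum]
  refine Finset.sum_le_sum fun z _ => ?_
  have h := norm_bmeanIterW_sub_bmeanW_le hL j hWu hx hsm hWx ξ z
  -- Jensen on the block
  have hJ := blockMean_norm_sq_le (n := n) hM1 ξ (((L ^ (j + 1) : ℕ) : ℤ) • z)
  rw [hMr] at hJ h
  have hmean : (((L : ℝ) ^ (j + 1)) ^ d)⁻¹ * ∑ v ∈ periodBox (d := d) (L ^ (j + 1)), ‖ξ (((L ^ (j + 1) : ℕ) : ℤ) • z + v)‖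
      = ∑ r : Fin d → Fin (L ^ (j + 1)), (((L : ℝ) ^ (j + 1)) ^ d)⁻¹ * ‖ξ (((L ^ (j + 1) : ℕ) : ℤ) • z + boxVec (L ^ (j + 1)) r)‖ := by
    rw [Finset.mul_sum, sum_univ_boxVec (L ^ (j + 1)) (fun v => (((L : ℝ) ^ (j + 1)) ^ d)⁻¹ * ‖ξ (((L ^ (j + 1) : ℕ) : ℤ) • z + v)‖)]
  rw [hmean] at h
  have hsq : ∑ r : Fin d → Fin (L ^ (j + 1)), ‖ξ (((L ^ (j + 1) : ℕ) : ℤ) • z + boxVec (L ^ (j + 1)) r)‖ ^ 2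
      = ∑ v ∈ periodBox (d := d) (L ^ (j + 1)), ‖ξ (((L ^ (j + 1) : ℕ) : ℤ) • z + v)‖ ^ 2 :=
    sum_univ_boxVec (L ^ (j + 1)) (fun v => ‖ξ (((L ^ (j + 1) : ℕ) : ℤ) • z + v)‖ ^ 2)
  rw [hsq] at hJ
  have h0 : 0 ≤ ‖bmeanIterW L (j + 1) W ξ z - bmeanW (L ^ (j + 1)) W ξ z‖ := norm_nonneg _
  have h2 := pow_le_pow_left₀ h0 h 2
  rw [mul_pow] at h2
  have hC0 : 0 ≤ C ^ 2 := sq_nonneg C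
  calc ((L : ℝ) ^ (j + 1)) ^ d * ‖bmeanIterW L (j + 1) W ξ z - bmeanW (L ^ (j + 1)) W ξ z‖ ^ 2
      ≤ ((L : ℝ) ^ (j + 1)) ^ d * (C ^ 2 * ((((L : ℝ) ^ (j + 1)) ^ d)⁻¹
          * ∑ v ∈ periodBox (d := d) (L ^ (j + 1)), ‖ξ (((L ^ (j + 1) : ℕ) : ℤ) • z + v)‖ ^ 2)) :=
        mul_le_mul_of_nonneg_left (h2.trans (mul_le_mul_of_nonneg_left hJ hC0)) hMpos.le
    _ = C ^ 2 * ∑ v ∈ periodBox (d := d) (L ^ (j + 1)), ‖ξ (((L ^ (j + 1) : ℕ) : ℤ) • z + v)‖ ^ 2 := by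
        field_simp

/-! ## §5b (v1.1, append-only) The bridge in K2's normalised Hilbert–Schmidt currency -/

/-- **THE BRIDGE IN K2's NORMALISED HILBERT–SCHMIDT CURRENCY** (same class): `Σ_z M^d·nhsNormSq(bmeanIterW − bmeanW) ≤ card n·C²·Σ_y nhsNormSq(ξ y)`
(`nhsNormSq ≤ ‖·‖²_op ≤ card n·nhsNormSq`, the tree's `MatrixNorms`) — the form K6 adds to leaf-04's `NE3CovariantBlockPoincare.sum_nhsNormSq_sub_combMean_le`
to bound S4's `‖ζ′ − psiExt(bmeanIterW ζ′)‖`. [folklore] -/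
theorem sum_nhsNormSq_bmeanIterW_sub_bmeanW_le [Nonempty n] {L : ℕ} (hL : 2 ≤ L) (j : ℕ) {W : Site d → Fin d → (Matrix n n ℂ)ˣ}
    {x : ℝ} (hWu : IsUnitaryCfg W) (hx : 0 ≤ x) (hsm : LevelSmall d L j x) (hWx : SmallField W x)
    (ξ : Site d → Matrix n n ℂ) (N : ℕ) :
    ∑ z ∈ periodBox (d := d) N, ((L : ℝ) ^ (j + 1)) ^ d * MatrixNorms.nhsNormSq (bmeanIterW L (j + 1) W ξ z - bmeanW (L ^ (j + 1)) W ξ z)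
      ≤ Fintype.card n * (4 * (d : ℝ) ^ 2 * ((L : ℝ) ^ (j + 1) - 1) ^ 2 * x + 16 * d * loopRad d L ((prop1Radius d L)^[j] x)) ^ 2
        * ∑ y ∈ periodBox (d := d) (L ^ (j + 1) * N), MatrixNorms.nhsNormSq (ξ y) := by
  have h := sum_norm_bmeanIterW_sub_bmeanW_sq_le hL j hWu hx hsm hWx ξ N
  calc ∑ z ∈ periodBox (d := d) N, ((L : ℝ) ^ (j + 1)) ^ d * MatrixNorms.nhsNormSq (bmeanIterW L (j + 1) W ξ z - bmeanW (L ^ (j + 1)) W ξ z)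
      ≤ ∑ z ∈ periodBox (d := d) N, ((L : ℝ) ^ (j + 1)) ^ d * ‖bmeanIterW L (j + 1) W ξ z - bmeanW (L ^ (j + 1)) W ξ z‖ ^ 2 :=
        Finset.sum_le_sum fun z _ => mul_le_mul_of_nonneg_left (MatrixNorms.nhsNormSq_le_opNorm_sq _) (by positivity)
    _ ≤ (4 * (d : ℝ) ^ 2 * ((L : ℝ) ^ (j + 1) - 1) ^ 2 * x + 16 * d * loopRad d L ((prop1Radius d L)^[j] x)) ^ 2
        * ∑ y ∈ periodBox (d := d) (L ^ (j + 1) * N), ‖ξ y‖ ^ 2 := h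
    _ ≤ (4 * (d : ℝ) ^ 2 * ((L : ℝ) ^ (j + 1) - 1) ^ 2 * x + 16 * d * loopRad d L ((prop1Radius d L)^[j] x)) ^ 2
        * ∑ y ∈ periodBox (d := d) (L ^ (j + 1) * N), (Fintype.card n * MatrixNorms.nhsNormSq (ξ y)) :=
        mul_le_mul_of_nonneg_left (Finset.sum_le_sum fun y _ => MatrixNorms.opNorm_sq_le_card_mul_nhsNormSq _) (sq_nonneg _)
    _ = _ := by rw [← Finset.mul_sum]; ring

end

end Summit.QuantumFields.BalabanUV.T4Continuum.NE3NestedBlockMeanBridge
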